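import Summits.BirchSwinnertonDyer.BirchSwinnertonDyer.Theses.UniversalToricDescent
import Summits.BirchSwinnertonDyer.BirchSwinnertonDyer.Theorems.UniversalToricDescentToricKernelAtThreeDegreeOnlyTwinOfPrint
import HarnessLib
-- buildfix (bf3-g30) G30-43: comment-only touch to re-dispatch the lane build (dead-lettered rc 76 att 7 (15:53–16:15) behind Theorems.UniversalToricDescentToricKernelAtThreeApZeroOddDefectPTTROfPrint, which was red between the route's 15:07/16:10 closes re-keys and my re-glues (G30-30/G30-36, hub olean 16:18); file farm rc 0); declarations byte-identical

/-!
# Route `UniversalToricDescent` — kernel⁵ `ToricKernelAtThreeApZeroOddDegreeOfPrint` (stmt-BirchSwinnertonDyer-22543) BY NAME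

Act DEG (T10 «degree-only twin clause», utd-idea g25; pen bsd-wall-pss3x g5, route rev 69; LEAD bsd-wall-utd-p2 g15
endorsement 2026-08-28T14:19:41Z). The `closes` binder `hK` of the route is now kernel⁵: the text of the act-R kernel⁗
`ToricKernelAtThreeApZeroOddDefectPTTROfPrint` (stmt-…-27389, proved p626132) with its fifth hypothesis — the twin package
P_R `TwinWanFrameAtThreeNonOrdBucketsTR` — REPLACED by the degree package
`TwinDegreeFrameAtThreeMultTresT ∧ TwinDegreeFrameAtThreeGoodSSApZeroT` (♭B′° 22539 ∧ ♭C₀° 22540). Its proof is the landed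
TURNKEY theorem `UniversalToricDescentKernelDegreeOnlyTwinOfPrint.bsdp_three_of_degreePackage_of_print` (p640116, width seat
bsd-wall-utd-p2-w2 g6), whose hypotheses are these eleven route declarations δ-unfolded; this file is the one-line by-name
closer (`--workitem stmt-BirchSwinnertonDyer-22543`; pen certificate `utdD/SketchD2.lean` 68b150fa45cb5760).

HONEST FRAMING: kernel⁵ is an IMPLICATION between route items; proving it closes the support item 22543 and nothing else —
its antecedents ♭T′ 26975, the wall 20395, ♭B′° 22539, ♭C₀° 22540, the rank-zero leaf 20387 … stay research / open.
BSD is proved for no curve by this file. References: [GreenbergVatsal2000] Thm. (1.4); [JetchevSkinnerWan2017] §7.4.1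
(the pointwise kernel's printed inputs, as in p626132 / p640116).
-/

set_option linter.dupNamespace false
set_option autoImplicit false

namespace Summit.BirchSwinnertonDyer.BirchSwinnertonDyer.Theorems.UniversalToricDescentToricKernelAtThreeApZeroOddDegreeOfPrint

open Summit.BirchSwinnertonDyer.BirchSwinnertonDyer.Theses.UniversalToricDescent
  Summit.BirchSwinnertonDyer.BirchSwinnertonDyer.Theorems.UniversalToricDescentKernelDegreeOnlyTwinOfPrint

/-- **kernel⁵ `ToricKernelAtThreeApZeroOddDegreeOfPrint` (item stmt-BirchSwinnertonDyer-22543) BY NAME**: the eleven printed /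
research inputs of the route, with the twin entering only through the DEGREE package ♭B′° ∧ ♭C₀°, imply `BSDp W 3` for every
wild `O6` curve `W` of analytic rank one with `ρ̄₃` onto that has a `3`-congruent non-additive twin. Proof = the width seat's
turnkey `bsdp_three_of_degreePackage_of_print` (p640116) applied to the hypotheses in order. CONDITIONAL on every displayed
antecedent (this is an implication); closes the support item only. [cite: GreenbergVatsal2000, Thm. (1.4)]
[cite: JetchevSkinnerWan2017, §7.4.1] -/
theorem toricKernelAtThreeApZeroOddDegreeOfPrint_proof : ToricKernelAtThreeApZeroOddDegreeOfPrint := by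
  intro hF hD hA hM h3 hsupply hres hW hS hL hZ
  exact bsdp_three_of_degreePackage_of_print hF hD hA hM h3 hsupply hres hW hS hL hZ

end Summit.BirchSwinnertonDyer.BirchSwinnertonDyer.Theorems.UniversalToricDescentToricKernelAtThreeApZeroOddDegreeOfPrint
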